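import Summits.Langlands.Langlands.Theses.ThreeTorsionCollapse
import Literature.NumberTheory.Automorphic.TotallyRealModularityX0Fifteen
import Literature.NumberTheory.GaloisRepresentations.OrdinaryGaloisRep

/-!
# Line `threelocal` — crux `SplitCartanThreeAutomorphic` (stmt-Langlands-18556) of route
# `Langlands/ThreeTorsionCollapse`: split the `C_s⁺(3)` cell by its RESIDUAL TYPE AT 3 and by the
# LOCAL 3-ADIC SHAPE of `ρ_{E,3}` above 3 (strategist's alternative to `Lines/birth.lean`, which
# splits by the auxiliary primes 5 and 7).

The crux: `K` totally real, `E / 𝓞 K` with `Δ ≠ 0`, some framing `ρ̄` of `E[3]` with image in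
`C_s⁺(3) = N_s(3) = ⟨diag(1,2), antidiag(1,1)⟩ ≅ D₄` ⇒ `E` automorphic of weight zero.

Inside the cell `det ρ̄ = χ̄₃` is onto (`K` is totally real), so exactly two residual types occur:
(R) `E[3]` reducible — image in `C_s(3)` up to the frame, `E[3] ≅ ψ ⊕ ψχ̄₃` (the Hesse pencil and
its quadratic twists, up to 3-isogeny); (I) `E[3]` irreducible — image all of `N_s(3) ≅ D₄`,
`ρ̄ ⊗ 𝔽₉ ≅ Ind_{K(√-3)}^K χ̄` with `χ̄` of order 4, absolutely irreducible over `K` but with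
`ρ̄(G_{K(ζ₃)}) = N_s(3) ∩ SL₂(𝔽₃) = C₄` absolutely REDUCIBLE: the Taylor–Wiles / FLS Thm. 3
hypothesis fails for every `K`, while Skinner–Wiles 2001 ("including the cases where `ρ̄^ss` is
reducible over `F(ζ_p)`", afst-988 p. 4) is built for exactly this.  In type (I) every decomposition
group `D_w` (`w ∣ 3`) at which `E` is nearly ordinary has reducible image inside `D₄`, hence an
elementary abelian 2-group, so `ρ̄|_{D_w} = θ₁ ⊕ θ₂` with `θᵢ² = 1`, `θ₁θ₂ = χ̄₃`; therefore
`ρ̄` is `D_w`-DISTINGUISHED iff `χ̄₃|_{D_w} ≠ 1` iff `ζ₃ ∉ K_w` iff `¬ IsSquare (-3 : K_w)`.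

Stubs (five; two printed doors, three open cores), glued by the exhaustive case analysis
reducible? / nearly ordinary above 3? / distinguished above 3? / Pan–Zhang shape?:

* `stub_splitReducibleCore` — type (R) ⇒ modular.  OPEN uniformly in `K`; it is the shadow of the
  sister crux `BorelThreeAutomorphic` (stmt-Langlands-18557: a reducible `E[3]` admits a Borel
  framing), so it costs the ROUTE nothing beyond 18557; printed sub-cell: Freitas 2015 Thm. 6.2 (3)
  (`K` abelian, 3 unramified, semistable above 3, via Skinner–Wiles 1999).
* `stub_skinnerWilesDoor` — type (I), `ρ_{E,3}` nearly ordinary of weight 2 at every `w ∣ 3`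
  (tree `FramedGaloisRep.IsOrdinaryOfWeightAt 3 · w 2 m` on an irreducible Tate frame, the
  vocabulary of routes FifteenLocusEisenstein / SkinnerWilesDefectOne) and `ζ₃ ∉ K_w` for every
  `w ∣ 3` ⇒ modular.  PRINTED ENGINE: Skinner–Wiles 2001 Thm. 5.1 (afst-988 p. 20) + an ordinary
  automorphic lift of `ρ̄` (Langlands–Tunnell / dihedral theta series in weight 1, Ellenberg's local
  computation, Wiles 1988 Thms. 1.4.1 and 2.1.4), assembled verbatim in Freitas, arXiv:1203.3371
  pp. 17–18 for the rung "3 unramified in `K`, `E` semistable above 3" (Math. Z. 2015, Thm. 6.2 (2)).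
* `stub_nonDistinguishedCore` — type (I), nearly ordinary above 3, but `ζ₃ ∈ K_w` at some `w ∣ 3`
  ⇒ modular.  OPEN CORE A (no printed engine: SW 2001 needs distinguishedness, Geraghty/BLGGT
  ordinary lifting needs `ρ̄(G_{K(ζ₃)})` adequate, Pan/Zhang need `K_w = ℚ₃ ∌ ζ₃`, Thorne 2026
  Thm. 4.1 needs a modular lift congruent mod `3^{80C+1}`).
* `stub_panZhangDoor` — type (I), 3 totally split in `K`, `ρ_{E,3}|_{G_{K_w}}` irreducible
  (potentially supersingular) at every `w ∣ 3` ⇒ modular.  PRINTED ENGINE: X. Zhang 2024,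
  arXiv:2412.06812 Thm. 6.1.1 (`p = 3` allowed, no `F(ζ_p)` condition; residual automorphy by a
  CM theta lift of `Ind χ̄`).
* `stub_supersingularCore` — type (I), NOT nearly ordinary above 3 and NOT of Pan–Zhang shape
  (some `w ∣ 3` potentially supersingular with `K_w ≠ ℚ₃`, or mixed ordinary/supersingular places)
  ⇒ modular.  OPEN CORE B (barrier `ModPLanglandsGL2BeyondQp`: no `p`-adic Langlands for
  `GL₂(K_w)`, `K_w ≠ ℚ_p`).

`SplitCartanThreeAutomorphic_of_stubs` is the kernel-checked glue (no `sorry`) and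
`SplitCartanThreeAutomorphic_of : SplitCartanThreeAutomorphic` the registered skeleton theorem.

## Lead's reshape (prover-line-stmt-Langlands-18556-0, cycle 1, 2026-08-17)

Core R is the sister crux's business, and the skeleton now SAYS so in the kernel: the open stub
`stub_splitReducibleCore` of the strategist's file is replaced by
* `stub_borelThreeAutomorphic : BorelThreeAutomorphic` — the sister crux
  `Summit.Langlands.Langlands.Theses.ThreeTorsionCollapse.BorelThreeAutomorphic` (item
  stmt-Langlands-18557) BY NAME, a fact-stub never worked from this line (it closes when 18557 does);
* `stub_splitReducibleCore_of_borel : BorelThreeAutomorphic → <R body verbatim>` — PROVABLE NOW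
  (change of framing: `¬ HasIrreducibleModPGaloisRep 3` makes the given framing reducible by
  `hasIrreducibleModPGaloisRep_of_isIrreducible`, a reducible framing is conjugate to an
  upper-triangular one by `FLS2015.exists_isTorsionGaloisRep_borel_of_not_isIrreducible`, and the
  sister crux concludes), S-sized, delegated in wave 1.
The other four stubs are registered VERBATIM from `Lines/threelocal.lean` (sha d2579115…); the glue
`SplitCartanThreeAutomorphic_of_stubs` is byte-identical and is fed
`stub_splitReducibleCore_of_borel stub_borelThreeAutomorphic` in the `hR` slot.
-/

namespace Summit.Langlands.Langlands.Cruxes.SplitCartanThreeAutomorphic.ThreeLocal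

open scoped NumberField MatrixGroups Polynomial
open NumberField IsDedekindDomain Filter
open Literature.NumberTheory.Automorphic Literature.NumberTheory.GaloisRepresentations
open Summit.Langlands.Langlands.Theses.ThreeTorsionCollapse

/-! ## Vocabulary (all inline, over existing tree declarations)

* `N_s(3)`-framing: `∀ σ, ρ̄ σ ∈ Subgroup.closure {diag(1,2), antidiag(1,1)}` (the crux, verbatim).
* TATE FRAME of `E` at 3: `ρ₃ : FramedGaloisRep K (PadicAlgCl 3) 2` irreducible, unramified at almost
  every `w` with `HasFrobCharpolyAt w (X² − a_w(E) X + N w)` (`a_w = frobTraceAt E w`) — exactly the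
  `GL₂(ℚ̄₃)`-conjugates of `V₃(E) ⊗ ℚ̄₃` (Hasse–Weil, Chebotarev + Brauer–Nesbitt, Serre/Faltings;
  for CM `E` irreducibility over the totally real `K` by induction from the CM field); the frame
  vocabulary of route `FifteenLocusEisenstein` at `p = 5`.
* NEARLY ORDINARY ABOVE 3: some Tate frame is `IsOrdinaryOfWeightAt 3 ρ₃ w 2 m` (`m ≥ 1`) at every
  `w ∣ 3` (`ρ₃|_{D_w} ≅ (ψ₁ε ∗ ; 0 ψ₂)`, `ψᵢ|_{I_w}^m = 1`: potentially multiplicative or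
  potentially good ordinary).
* DISTINGUISHED ABOVE 3 (the form it takes on the cell): `¬ IsSquare (-3 : K_w)` for all `w ∣ 3`.
* PAN–ZHANG SHAPE: 3 totally split in `K` (`3 ∤ d_K` and every `w ∣ 3` has residue field `𝔽₃`,
  typed exactly as in `Tung2021_hilbertTotallySplit`) and some Tate frame is irreducible on every
  `D_w`, `w ∣ 3` (potentially supersingular above 3).
-/

/-! ## The five stubs -/

/-- OPEN CORE R (split-reducible sub-cell = shadow of the sister crux `BorelThreeAutomorphic`,
stmt-Langlands-18557).  For `K` totally real and `E / 𝓞 K` with `Δ ≠ 0`: if a framing of `E[3]`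
has image in `N_s(3)` and `E[3]` is REDUCIBLE over `K`, then `E` is automorphic of weight zero.
Here the image sits in a split Cartan up to the frame, `E[3] ≅ ψ ⊕ ψχ̄₃` with `ψ` quadratic: up to a
quadratic twist and a 3-isogeny these are the `K`-points of the Hesse pencil.  Why it might fail / is
hard: residually reducible at 3 over a general totally real `K` — Skinner–Wiles 1999 needs
`K(χ₁/χ₂) = K(√-3)` abelian over `ℚ` (Freitas 2015 Thm. 6.2 (3) is the abelian-`K` rung), Pan 2022
Thms. 1.0.2/1.0.4 exclude precisely `χ̄₁/χ̄₂ = ω` at `p = 3` (here both characters are quadratic,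
so the ratio IS `ω`), Thorne 2026 Thm. B is only potential.  A reducible `E[3]` has a Borel framing, so this stub follows from
`BorelThreeAutomorphic` by a change of frame (it costs the ROUTE nothing beyond 18557).
[SkinnerWiles1999, Freitas2015 Thm 6.2(3), arXiv:2608.07186 Thm B]

FACT-STUB (lead's reshape, cycle 1): the sister crux BY NAME.  `BorelThreeAutomorphic` (item
stmt-Langlands-18557, rank 3 of this route: a framing of `E[3]` with all `(1,0)` entries zero ⇒
`E` automorphic of weight zero) is never worked from this line; the `sorry` below closes exactly
when 18557 closes (`BorelThreeAutomorphic_holds`).  It enters only through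
`stub_splitReducibleCore_of_borel`. -/
theorem stub_borelThreeAutomorphic : BorelThreeAutomorphic := by
  sorry

/-- CORE R REDUCED TO THE SISTER CRUX (lead's reshape, cycle 1; PROVABLE NOW, S-sized).  For `K`
totally real and `E / 𝓞 K` with `Δ ≠ 0`: if a framing `ρ̄` of `E[3]` has image in `N_s(3)` and
`E[3]` is REDUCIBLE over `K` (`¬ HasIrreducibleModPGaloisRep 3`), then — GRANTED the sister crux
`BorelThreeAutomorphic` — `E` is automorphic of weight zero.  Proof plan: `¬ HasIrreducibleModPGaloisRep 3`
and `hasIrreducibleModPGaloisRep_of_isIrreducible hρ` give `¬ FramedRep.IsIrreducible ρ̄`;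
`FLS2015.exists_isTorsionGaloisRep_borel_of_not_isIrreducible hρ` then yields a framing `ρ̄'` of
`E[3]` with `IsTorsionGaloisRep 3 ρ̄'` (definitionally the sister crux's written-out framing
hypothesis) and all `(1,0)` entries zero; apply `BorelThreeAutomorphic K E hΔ ρ̄' hρ̄' hB`.  The
`N_s(3)` hypothesis is not used (the statement is kept in the registered shape of line threelocal).
[folklore] -/
theorem stub_splitReducibleCore_of_borel : BorelThreeAutomorphic →
    ∀ (K : Type) [Field K] [NumberField K] [IsTotallyReal K] (E : WeierstrassCurve (𝓞 K)),
      E.Δ ≠ 0 → ∀ ρ : FramedGaloisRep K (ZMod 3) 2, (E.baseChange K).IsTorsionGaloisRep 3 ρ →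
        (∀ σ : Field.absoluteGaloisGroup K, (ρ σ : GL (Fin 2) (ZMod 3)) ∈
          Subgroup.closure ({(⟨!![1, 0; 0, 2], !![1, 0; 0, 2], by decide, by decide⟩ :
              GL (Fin 2) (ZMod 3)),
            (⟨!![0, 1; 1, 0], !![0, 1; 1, 0], by decide, by decide⟩ : GL (Fin 2) (ZMod 3))} :
            Set (GL (Fin 2) (ZMod 3)))) →
        ¬ (E.baseChange K).HasIrreducibleModPGaloisRep 3 →
        IsAutomorphicOfWeightZero E := by
  sorry

/-- PRINTED DOOR (Skinner–Wiles 2001, Thm. 5.1, Ann. Fac. Sci. Toulouse 10, p. 20 of afst-988 —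
"including the cases where `ρ̄^ss` is reducible over `F(ζ_p)`", p. 4; assembled for elliptic curves
with dihedral mod-3 image verbatim as in Freitas, Math. Z. 279 (2015) Thm. 6.2 (2), arXiv:1203.3371
pp. 17–18).  For `K` totally real, `E / 𝓞 K` with `Δ ≠ 0`, a framing of `E[3]` with image in
`N_s(3)` and `E[3]` IRREDUCIBLE (so the image is all of `N_s(3) ≅ D₄`, absolutely irreducible,
`ρ̄ ⊗ 𝔽₉ ≅ Ind_{K(√-3)}^K χ̄`): if `E` is nearly ordinary of weight 2 at every `w ∣ 3` and
`ζ₃ ∉ K_w` for every `w ∣ 3`, then `E` is automorphic of weight zero.  On this cell `ζ₃ ∉ K_w` IS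
`D_w`-distinguishedness: `ρ̄(D_w)` is a reducible subgroup of `D₄`, hence elementary abelian of
exponent 2, so `ρ̄|_{D_w} = θ₁ ⊕ θ₂` with `θᵢ² = 1`, `θ₁θ₂ = χ̄₃|_{D_w}`, and `θ₁ ≠ θ₂` iff
`χ̄₃|_{D_w} ≠ 1`.  Proof from print: `ρ = ρ_{E,3}` satisfies SW (5.1)(i)–(v); `ρ̄^ss = ρ̄` is
irreducible and `D_w`-distinguished; an ordinary automorphic `χ₂`-good lift exists (odd dihedral
Artin lift `ι ∘ ρ̄` ⇒ weight-one Hilbert eigenform by Langlands–Tunnell / theta series; after a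
Grunwald–Wang twist its `U_w`-eigenvalues are units because `ι(ρ̄(D_w))` is diagonal with entries
`±1` — Ellenberg's computation; Wiles 1988 Thms. 1.4.1, 2.1.4 give the ordinary weight-two member of
the Hida family); SW Thm. 5.1 ⇒ `ρ` automorphic ⇒ a weight-zero `π` with Hecke polynomials
`X² − a_w X + N w` at `w ∤ Δ`.  Rung in print: 3 unramified in `K` and `E` semistable above 3
(Freitas Thm. 6.2 (2); JMano Lemma 9.1 gives near-ordinarity, `e_w = 1` gives `ζ₃ ∉ K_w`).  Size L
(vendoring SW 2001 Thm. 5.1 and the Hida-family input as named facts).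
[SkinnerWiles2001 Thm 5.1, Freitas2015 Thm 6.2(2), Wiles1988, Ellenberg2005] -/
theorem stub_skinnerWilesDoor :
    ∀ (K : Type) [Field K] [NumberField K] [IsTotallyReal K] (E : WeierstrassCurve (𝓞 K)),
      E.Δ ≠ 0 → ∀ ρ : FramedGaloisRep K (ZMod 3) 2, (E.baseChange K).IsTorsionGaloisRep 3 ρ →
        (∀ σ : Field.absoluteGaloisGroup K, (ρ σ : GL (Fin 2) (ZMod 3)) ∈
          Subgroup.closure ({(⟨!![1, 0; 0, 2], !![1, 0; 0, 2], by decide, by decide⟩ :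
              GL (Fin 2) (ZMod 3)),
            (⟨!![0, 1; 1, 0], !![0, 1; 1, 0], by decide, by decide⟩ : GL (Fin 2) (ZMod 3))} :
            Set (GL (Fin 2) (ZMod 3)))) →
        (E.baseChange K).HasIrreducibleModPGaloisRep 3 →
        (∃ ρ₃ : FramedGaloisRep K (PadicAlgCl 3) 2,
          (ρ₃.toGaloisRep.IsIrreducible ∧
            ∀ᶠ w : HeightOneSpectrum (𝓞 K) in cofinite, ρ₃.IsUnramifiedAt w ∧
              ρ₃.HasFrobCharpolyAt w (Polynomial.X ^ 2 -
                Polynomial.C ((frobTraceAt E w : ℤ) : PadicAlgCl 3) * Polynomial.X +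
                Polynomial.C ((w.residueCard : ℕ) : PadicAlgCl 3))) ∧
            ∀ w : HeightOneSpectrum (𝓞 K), (3 : 𝓞 K) ∈ w.asIdeal →
              ∃ m : ℕ, 0 < m ∧ ρ₃.IsOrdinaryOfWeightAt 3 w 2 m) →
        (∀ w : HeightOneSpectrum (𝓞 K), (3 : 𝓞 K) ∈ w.asIdeal →
          ¬ IsSquare (-3 : w.adicCompletion K)) →
        IsAutomorphicOfWeightZero E := by
  sorry

/-- OPEN CORE A (non-distinguished nearly ordinary dihedral cell) — the HARDEST stub.  For `K`
totally real, `E / 𝓞 K` with `Δ ≠ 0`, a framing of `E[3]` with image in `N_s(3)`, `E[3]`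
irreducible and `E` nearly ordinary of weight 2 at every `w ∣ 3`: if `ζ₃ ∈ K_w` at SOME `w ∣ 3`
(then `[K_w : ℚ₃]` is even and `ρ̄|_{D_w} = θ ⊕ θ` is NOT distinguished), `E` is still automorphic
of weight zero.  Why it might fail / is hard: the cell is the intersection of two barriers —
residual dihedral degeneracy (`ρ̄(G_{K(ζ₃)}) = N_s(3) ∩ SL₂(𝔽₃) = C₄` is abelian, so Taylor–Wiles–
Kisin, FLS Thm. 3, Thorne 2016 and Geraghty/BLGGT ordinary lifting — which need adequacy — are all
void) and non-distinguishedness (Skinner–Wiles 2001 hypothesis (i), and the uniqueness of the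
ordinary line in Hida theory, fail); Pan 2022 / Zhang 2024 need `K_w = ℚ₃`, which excludes
`ζ₃ ∈ K_w`; Thorne 2026 Thm. 4.1 needs an ordinary automorphic lift congruent to `ρ_{E,3}` modulo
`3^(80 C(ρ)+1)`, and his Thm. B gives only potential modularity (already known for elliptic
curves).  Smallest fields: `K = ℚ(√6)`, `ℚ(√33)` (`-3` becomes a square in `K_w`).
[SkinnerWiles2001 §5, arXiv:2608.07186 Thms B and 4.1, arXiv:2412.06812 Rem 6.1.2] -/
theorem stub_nonDistinguishedCore :
    ∀ (K : Type) [Field K] [NumberField K] [IsTotallyReal K] (E : WeierstrassCurve (𝓞 K)),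
      E.Δ ≠ 0 → ∀ ρ : FramedGaloisRep K (ZMod 3) 2, (E.baseChange K).IsTorsionGaloisRep 3 ρ →
        (∀ σ : Field.absoluteGaloisGroup K, (ρ σ : GL (Fin 2) (ZMod 3)) ∈
          Subgroup.closure ({(⟨!![1, 0; 0, 2], !![1, 0; 0, 2], by decide, by decide⟩ :
              GL (Fin 2) (ZMod 3)),
            (⟨!![0, 1; 1, 0], !![0, 1; 1, 0], by decide, by decide⟩ : GL (Fin 2) (ZMod 3))} :
            Set (GL (Fin 2) (ZMod 3)))) →
        (E.baseChange K).HasIrreducibleModPGaloisRep 3 →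
        (∃ ρ₃ : FramedGaloisRep K (PadicAlgCl 3) 2,
          (ρ₃.toGaloisRep.IsIrreducible ∧
            ∀ᶠ w : HeightOneSpectrum (𝓞 K) in cofinite, ρ₃.IsUnramifiedAt w ∧
              ρ₃.HasFrobCharpolyAt w (Polynomial.X ^ 2 -
                Polynomial.C ((frobTraceAt E w : ℤ) : PadicAlgCl 3) * Polynomial.X +
                Polynomial.C ((w.residueCard : ℕ) : PadicAlgCl 3))) ∧
            ∀ w : HeightOneSpectrum (𝓞 K), (3 : 𝓞 K) ∈ w.asIdeal →
              ∃ m : ℕ, 0 < m ∧ ρ₃.IsOrdinaryOfWeightAt 3 w 2 m) →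
        ¬ (∀ w : HeightOneSpectrum (𝓞 K), (3 : 𝓞 K) ∈ w.asIdeal →
          ¬ IsSquare (-3 : w.adicCompletion K)) →
        IsAutomorphicOfWeightZero E := by
  sorry

/-- PRINTED DOOR (X. Zhang 2024, arXiv:2412.06812 Thm. 6.1.1, p. 33: `F` totally real with `p`
completely split, `ρ̄` absolutely irreducible, `ρ|_{G_{F_v}}` absolutely irreducible and de Rham
of distinct Hodge–Tate weights for all `v ∣ p`, `ρ` totally odd, `ρ̄` automorphic ⇒ `ρ` automorphic;
`p = 3` allowed and NO condition on `ρ̄|_{G_{F(ζ_p)}}` — Skinner–Wiles-style pro-modularity plus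
`p`-adic local Langlands for `GL₂(ℚ_p)` with the Paškūnas–Tung blocks).  For `K` totally real with 3
totally split, `E / 𝓞 K` with `Δ ≠ 0`, a framing of `E[3]` with image in `N_s(3)` and `E[3]`
irreducible: if `E` is potentially supersingular at every `w ∣ 3` (`ρ_{E,3}|_{D_w}` irreducible),
then `E` is automorphic of weight zero.  Residual automorphy input: `ρ̄ ⊗ 𝔽₉ ≅ Ind_{K(√-3)}^K χ̄`
is the reduction of the (regular algebraic, cuspidal) theta series of an algebraic Hecke character
of the CM field `K(√-3)` lifting `χ̄`.  Why it might fail: vendoring Thm. 6.1.1 over a totally real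
field (the tree holds only the `F = ℚ` member `XZhang2024_fontaineMazurGL2_*`) and the CM-lift
lemma; size L. [arXiv:2412.06812 Thm 6.1.1, Pan2022] -/
theorem stub_panZhangDoor :
    ∀ (K : Type) [Field K] [NumberField K] [IsTotallyReal K] (E : WeierstrassCurve (𝓞 K)),
      E.Δ ≠ 0 → ∀ ρ : FramedGaloisRep K (ZMod 3) 2, (E.baseChange K).IsTorsionGaloisRep 3 ρ →
        (∀ σ : Field.absoluteGaloisGroup K, (ρ σ : GL (Fin 2) (ZMod 3)) ∈
          Subgroup.closure ({(⟨!![1, 0; 0, 2], !![1, 0; 0, 2], by decide, by decide⟩ :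
              GL (Fin 2) (ZMod 3)),
            (⟨!![0, 1; 1, 0], !![0, 1; 1, 0], by decide, by decide⟩ : GL (Fin 2) (ZMod 3))} :
            Set (GL (Fin 2) (ZMod 3)))) →
        (E.baseChange K).HasIrreducibleModPGaloisRep 3 →
        ((¬ ((3 : ℤ) ∣ NumberField.discr K)) ∧
          (∀ v : HeightOneSpectrum (𝓞 K), (3 : 𝓞 K) ∈ v.asIdeal → v.residueCard = 3) ∧
          ∃ ρ₃ : FramedGaloisRep K (PadicAlgCl 3) 2,
          (ρ₃.toGaloisRep.IsIrreducible ∧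
            ∀ᶠ w : HeightOneSpectrum (𝓞 K) in cofinite, ρ₃.IsUnramifiedAt w ∧
              ρ₃.HasFrobCharpolyAt w (Polynomial.X ^ 2 -
                Polynomial.C ((frobTraceAt E w : ℤ) : PadicAlgCl 3) * Polynomial.X +
                Polynomial.C ((w.residueCard : ℕ) : PadicAlgCl 3))) ∧
            ∀ w : HeightOneSpectrum (𝓞 K), (3 : 𝓞 K) ∈ w.asIdeal →
              FramedRep.IsIrreducible (ρ₃.toLocal w)) →
        IsAutomorphicOfWeightZero E := by
  sorry

/-- OPEN CORE B (supersingular-above-3 dihedral cell beyond `ℚ₃`).  For `K` totally real,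
`E / 𝓞 K` with `Δ ≠ 0`, a framing of `E[3]` with image in `N_s(3)` and `E[3]` irreducible: if `E`
is NOT nearly ordinary above 3 (some `w ∣ 3` is potentially supersingular — necessarily with
`e_w ≥ 2` or additive reduction, since good supersingular reduction with `e_w = 1` puts an element
of order 8 into `ρ̄(I_w) ⊂ D₄`) and NOT of Pan–Zhang shape (3 is not totally split in `K`, or some
other place above 3 is nearly ordinary), then `E` is automorphic of weight zero.  Why it might
fail / is hard: supersingular modularity lifting at `p = 3` for `ρ̄(G_{K(ζ₃)})` absolutely reducible
exists in print only through `p`-adic local Langlands for `GL₂(ℚ₃)` (Pan, Zhang: `K_w = ℚ₃`); for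
`K_w ≠ ℚ₃` there is no `p`-adic / mod-`p` Langlands correspondence to patch with (barrier
`Literature.Barriers.Langlands.ModPLanglandsGL2BeyondQp`), and Kisin's connectedness of `X_{K,τ}`
is a Taylor–Wiles argument.  Mixed ordinary/supersingular places over a split 3 are probably within
reach of the Pan–Zhang method but are not printed. [arXiv:2412.06812 §6, Kisin2009,
BreuilPaskunas2012] -/
theorem stub_supersingularCore :
    ∀ (K : Type) [Field K] [NumberField K] [IsTotallyReal K] (E : WeierstrassCurve (𝓞 K)),
      E.Δ ≠ 0 → ∀ ρ : FramedGaloisRep K (ZMod 3) 2, (E.baseChange K).IsTorsionGaloisRep 3 ρ →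
        (∀ σ : Field.absoluteGaloisGroup K, (ρ σ : GL (Fin 2) (ZMod 3)) ∈
          Subgroup.closure ({(⟨!![1, 0; 0, 2], !![1, 0; 0, 2], by decide, by decide⟩ :
              GL (Fin 2) (ZMod 3)),
            (⟨!![0, 1; 1, 0], !![0, 1; 1, 0], by decide, by decide⟩ : GL (Fin 2) (ZMod 3))} :
            Set (GL (Fin 2) (ZMod 3)))) →
        (E.baseChange K).HasIrreducibleModPGaloisRep 3 →
        ¬ (∃ ρ₃ : FramedGaloisRep K (PadicAlgCl 3) 2,
          (ρ₃.toGaloisRep.IsIrreducible ∧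
            ∀ᶠ w : HeightOneSpectrum (𝓞 K) in cofinite, ρ₃.IsUnramifiedAt w ∧
              ρ₃.HasFrobCharpolyAt w (Polynomial.X ^ 2 -
                Polynomial.C ((frobTraceAt E w : ℤ) : PadicAlgCl 3) * Polynomial.X +
                Polynomial.C ((w.residueCard : ℕ) : PadicAlgCl 3))) ∧
            ∀ w : HeightOneSpectrum (𝓞 K), (3 : 𝓞 K) ∈ w.asIdeal →
              ∃ m : ℕ, 0 < m ∧ ρ₃.IsOrdinaryOfWeightAt 3 w 2 m) →
        ¬ ((¬ ((3 : ℤ) ∣ NumberField.discr K)) ∧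
          (∀ v : HeightOneSpectrum (𝓞 K), (3 : 𝓞 K) ∈ v.asIdeal → v.residueCard = 3) ∧
          ∃ ρ₃ : FramedGaloisRep K (PadicAlgCl 3) 2,
          (ρ₃.toGaloisRep.IsIrreducible ∧
            ∀ᶠ w : HeightOneSpectrum (𝓞 K) in cofinite, ρ₃.IsUnramifiedAt w ∧
              ρ₃.HasFrobCharpolyAt w (Polynomial.X ^ 2 -
                Polynomial.C ((frobTraceAt E w : ℤ) : PadicAlgCl 3) * Polynomial.X +
                Polynomial.C ((w.residueCard : ℕ) : PadicAlgCl 3))) ∧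
            ∀ w : HeightOneSpectrum (𝓞 K), (3 : 𝓞 K) ∈ w.asIdeal →
              FramedRep.IsIrreducible (ρ₃.toLocal w)) →
        IsAutomorphicOfWeightZero E := by
  sorry

/-! ## Assembly (sorry-free glue + the registered skeleton theorem) -/

/-- GLUE (kernel-checked, no `sorry`; conclusion = the crux statement written out verbatim, so that
the skeleton audit sees exactly one theorem concluding the crux BY NAME).  Fix `K, E, ρ̄` with the
framing and the `N_s(3)` image.  If `E[3]` is reducible: core R.  Else, if `E` is nearly ordinary
above 3: the Skinner–Wiles door when `ζ₃ ∉ K_w` for all `w ∣ 3`, core A otherwise.  Else: the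
Pan–Zhang door when 3 is totally split and every place above 3 is supersingular, core B otherwise.
(`Classical.byCases` three times; the case propositions are read off the stub types.) -/
theorem SplitCartanThreeAutomorphic_of_stubs
    (hR : ∀ (K : Type) [Field K] [NumberField K] [IsTotallyReal K] (E : WeierstrassCurve (𝓞 K)),
      E.Δ ≠ 0 → ∀ ρ : FramedGaloisRep K (ZMod 3) 2, (E.baseChange K).IsTorsionGaloisRep 3 ρ →
        (∀ σ : Field.absoluteGaloisGroup K, (ρ σ : GL (Fin 2) (ZMod 3)) ∈
          Subgroup.closure ({(⟨!![1, 0; 0, 2], !![1, 0; 0, 2], by decide, by decide⟩ :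
              GL (Fin 2) (ZMod 3)),
            (⟨!![0, 1; 1, 0], !![0, 1; 1, 0], by decide, by decide⟩ : GL (Fin 2) (ZMod 3))} :
            Set (GL (Fin 2) (ZMod 3)))) →
        ¬ (E.baseChange K).HasIrreducibleModPGaloisRep 3 →
        IsAutomorphicOfWeightZero E)
    (hSW : ∀ (K : Type) [Field K] [NumberField K] [IsTotallyReal K] (E : WeierstrassCurve (𝓞 K)),
      E.Δ ≠ 0 → ∀ ρ : FramedGaloisRep K (ZMod 3) 2, (E.baseChange K).IsTorsionGaloisRep 3 ρ →
        (∀ σ : Field.absoluteGaloisGroup K, (ρ σ : GL (Fin 2) (ZMod 3)) ∈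
          Subgroup.closure ({(⟨!![1, 0; 0, 2], !![1, 0; 0, 2], by decide, by decide⟩ :
              GL (Fin 2) (ZMod 3)),
            (⟨!![0, 1; 1, 0], !![0, 1; 1, 0], by decide, by decide⟩ : GL (Fin 2) (ZMod 3))} :
            Set (GL (Fin 2) (ZMod 3)))) →
        (E.baseChange K).HasIrreducibleModPGaloisRep 3 →
        (∃ ρ₃ : FramedGaloisRep K (PadicAlgCl 3) 2,
          (ρ₃.toGaloisRep.IsIrreducible ∧
            ∀ᶠ w : HeightOneSpectrum (𝓞 K) in cofinite, ρ₃.IsUnramifiedAt w ∧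
              ρ₃.HasFrobCharpolyAt w (Polynomial.X ^ 2 -
                Polynomial.C ((frobTraceAt E w : ℤ) : PadicAlgCl 3) * Polynomial.X +
                Polynomial.C ((w.residueCard : ℕ) : PadicAlgCl 3))) ∧
            ∀ w : HeightOneSpectrum (𝓞 K), (3 : 𝓞 K) ∈ w.asIdeal →
              ∃ m : ℕ, 0 < m ∧ ρ₃.IsOrdinaryOfWeightAt 3 w 2 m) →
        (∀ w : HeightOneSpectrum (𝓞 K), (3 : 𝓞 K) ∈ w.asIdeal →
          ¬ IsSquare (-3 : w.adicCompletion K)) →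
        IsAutomorphicOfWeightZero E)
    (hA : ∀ (K : Type) [Field K] [NumberField K] [IsTotallyReal K] (E : WeierstrassCurve (𝓞 K)),
      E.Δ ≠ 0 → ∀ ρ : FramedGaloisRep K (ZMod 3) 2, (E.baseChange K).IsTorsionGaloisRep 3 ρ →
        (∀ σ : Field.absoluteGaloisGroup K, (ρ σ : GL (Fin 2) (ZMod 3)) ∈
          Subgroup.closure ({(⟨!![1, 0; 0, 2], !![1, 0; 0, 2], by decide, by decide⟩ :
              GL (Fin 2) (ZMod 3)),
            (⟨!![0, 1; 1, 0], !![0, 1; 1, 0], by decide, by decide⟩ : GL (Fin 2) (ZMod 3))} :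
            Set (GL (Fin 2) (ZMod 3)))) →
        (E.baseChange K).HasIrreducibleModPGaloisRep 3 →
        (∃ ρ₃ : FramedGaloisRep K (PadicAlgCl 3) 2,
          (ρ₃.toGaloisRep.IsIrreducible ∧
            ∀ᶠ w : HeightOneSpectrum (𝓞 K) in cofinite, ρ₃.IsUnramifiedAt w ∧
              ρ₃.HasFrobCharpolyAt w (Polynomial.X ^ 2 -
                Polynomial.C ((frobTraceAt E w : ℤ) : PadicAlgCl 3) * Polynomial.X +
                Polynomial.C ((w.residueCard : ℕ) : PadicAlgCl 3))) ∧
            ∀ w : HeightOneSpectrum (𝓞 K), (3 : 𝓞 K) ∈ w.asIdeal →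
              ∃ m : ℕ, 0 < m ∧ ρ₃.IsOrdinaryOfWeightAt 3 w 2 m) →
        ¬ (∀ w : HeightOneSpectrum (𝓞 K), (3 : 𝓞 K) ∈ w.asIdeal →
          ¬ IsSquare (-3 : w.adicCompletion K)) →
        IsAutomorphicOfWeightZero E)
    (hPZ : ∀ (K : Type) [Field K] [NumberField K] [IsTotallyReal K] (E : WeierstrassCurve (𝓞 K)),
      E.Δ ≠ 0 → ∀ ρ : FramedGaloisRep K (ZMod 3) 2, (E.baseChange K).IsTorsionGaloisRep 3 ρ →
        (∀ σ : Field.absoluteGaloisGroup K, (ρ σ : GL (Fin 2) (ZMod 3)) ∈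
          Subgroup.closure ({(⟨!![1, 0; 0, 2], !![1, 0; 0, 2], by decide, by decide⟩ :
              GL (Fin 2) (ZMod 3)),
            (⟨!![0, 1; 1, 0], !![0, 1; 1, 0], by decide, by decide⟩ : GL (Fin 2) (ZMod 3))} :
            Set (GL (Fin 2) (ZMod 3)))) →
        (E.baseChange K).HasIrreducibleModPGaloisRep 3 →
        ((¬ ((3 : ℤ) ∣ NumberField.discr K)) ∧
          (∀ v : HeightOneSpectrum (𝓞 K), (3 : 𝓞 K) ∈ v.asIdeal → v.residueCard = 3) ∧
          ∃ ρ₃ : FramedGaloisRep K (PadicAlgCl 3) 2,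
          (ρ₃.toGaloisRep.IsIrreducible ∧
            ∀ᶠ w : HeightOneSpectrum (𝓞 K) in cofinite, ρ₃.IsUnramifiedAt w ∧
              ρ₃.HasFrobCharpolyAt w (Polynomial.X ^ 2 -
                Polynomial.C ((frobTraceAt E w : ℤ) : PadicAlgCl 3) * Polynomial.X +
                Polynomial.C ((w.residueCard : ℕ) : PadicAlgCl 3))) ∧
            ∀ w : HeightOneSpectrum (𝓞 K), (3 : 𝓞 K) ∈ w.asIdeal →
              FramedRep.IsIrreducible (ρ₃.toLocal w)) →
        IsAutomorphicOfWeightZero E)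
    (hB : ∀ (K : Type) [Field K] [NumberField K] [IsTotallyReal K] (E : WeierstrassCurve (𝓞 K)),
      E.Δ ≠ 0 → ∀ ρ : FramedGaloisRep K (ZMod 3) 2, (E.baseChange K).IsTorsionGaloisRep 3 ρ →
        (∀ σ : Field.absoluteGaloisGroup K, (ρ σ : GL (Fin 2) (ZMod 3)) ∈
          Subgroup.closure ({(⟨!![1, 0; 0, 2], !![1, 0; 0, 2], by decide, by decide⟩ :
              GL (Fin 2) (ZMod 3)),
            (⟨!![0, 1; 1, 0], !![0, 1; 1, 0], by decide, by decide⟩ : GL (Fin 2) (ZMod 3))} :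
            Set (GL (Fin 2) (ZMod 3)))) →
        (E.baseChange K).HasIrreducibleModPGaloisRep 3 →
        ¬ (∃ ρ₃ : FramedGaloisRep K (PadicAlgCl 3) 2,
          (ρ₃.toGaloisRep.IsIrreducible ∧
            ∀ᶠ w : HeightOneSpectrum (𝓞 K) in cofinite, ρ₃.IsUnramifiedAt w ∧
              ρ₃.HasFrobCharpolyAt w (Polynomial.X ^ 2 -
                Polynomial.C ((frobTraceAt E w : ℤ) : PadicAlgCl 3) * Polynomial.X +
                Polynomial.C ((w.residueCard : ℕ) : PadicAlgCl 3))) ∧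
            ∀ w : HeightOneSpectrum (𝓞 K), (3 : 𝓞 K) ∈ w.asIdeal →
              ∃ m : ℕ, 0 < m ∧ ρ₃.IsOrdinaryOfWeightAt 3 w 2 m) →
        ¬ ((¬ ((3 : ℤ) ∣ NumberField.discr K)) ∧
          (∀ v : HeightOneSpectrum (𝓞 K), (3 : 𝓞 K) ∈ v.asIdeal → v.residueCard = 3) ∧
          ∃ ρ₃ : FramedGaloisRep K (PadicAlgCl 3) 2,
          (ρ₃.toGaloisRep.IsIrreducible ∧
            ∀ᶠ w : HeightOneSpectrum (𝓞 K) in cofinite, ρ₃.IsUnramifiedAt w ∧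
              ρ₃.HasFrobCharpolyAt w (Polynomial.X ^ 2 -
                Polynomial.C ((frobTraceAt E w : ℤ) : PadicAlgCl 3) * Polynomial.X +
                Polynomial.C ((w.residueCard : ℕ) : PadicAlgCl 3))) ∧
            ∀ w : HeightOneSpectrum (𝓞 K), (3 : 𝓞 K) ∈ w.asIdeal →
              FramedRep.IsIrreducible (ρ₃.toLocal w)) →
        IsAutomorphicOfWeightZero E) :
    ∀ (K : Type) [Field K] [NumberField K] [NumberField.IsTotallyReal K]
      (E : WeierstrassCurve (NumberField.RingOfIntegers K)), E.Δ ≠ 0 →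
      ∀ ρ : Literature.NumberTheory.GaloisRepresentations.FramedGaloisRep K (ZMod 3) 2,
        (∃ e : (E.baseChange K).geomTorsion ((3 : ℕ) : ℤ) ≃+ (Fin 2 → ZMod 3),
          ∀ (σ : Field.absoluteGaloisGroup K) (P : (E.baseChange K).geomTorsion ((3 : ℕ) : ℤ)),
            e (σ • P) = Matrix.mulVec ((ρ σ : GL (Fin 2) (ZMod 3)) : Matrix (Fin 2) (Fin 2) (ZMod 3))
              (e P)) →
        (∀ σ : Field.absoluteGaloisGroup K, (ρ σ : GL (Fin 2) (ZMod 3)) ∈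
          Subgroup.closure ({(⟨!![1, 0; 0, 2], !![1, 0; 0, 2], by decide, by decide⟩ :
              GL (Fin 2) (ZMod 3)),
            (⟨!![0, 1; 1, 0], !![0, 1; 1, 0], by decide, by decide⟩ : GL (Fin 2) (ZMod 3))} :
            Set (GL (Fin 2) (ZMod 3)))) →
        Literature.NumberTheory.Automorphic.IsAutomorphicOfWeightZero E := by
  intro K _ _ _ E hΔ ρ hρ hS
  exact Classical.byCases
    (fun hirr : (E.baseChange K).HasIrreducibleModPGaloisRep 3 =>
      Classical.byCases
        (fun hord => Classical.byCases (hSW K E hΔ ρ hρ hS hirr hord) (hA K E hΔ ρ hρ hS hirr hord))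
        (fun hord => Classical.byCases (hPZ K E hΔ ρ hρ hS hirr) (hB K E hΔ ρ hρ hS hirr hord)))
    (fun hirr => hR K E hΔ ρ hρ hS hirr)

/-- **SKELETON THEOREM (registered; concludes the crux BY NAME).**
`SplitCartanThreeAutomorphic` from the six declared stubs (lead's reshape: core R enters as
`stub_splitReducibleCore_of_borel stub_borelThreeAutomorphic`) through the sorry-free glue
`SplitCartanThreeAutomorphic_of_stubs`; the only `sorry`s in its closure are the six `stub_*`
bodies. -/
theorem SplitCartanThreeAutomorphic_of :
    Summit.Langlands.Langlands.Theses.ThreeTorsionCollapse.SplitCartanThreeAutomorphic :=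
  SplitCartanThreeAutomorphic_of_stubs (stub_splitReducibleCore_of_borel stub_borelThreeAutomorphic)
    stub_skinnerWilesDoor stub_nonDistinguishedCore stub_panZhangDoor stub_supersingularCore

end Summit.Langlands.Langlands.Cruxes.SplitCartanThreeAutomorphic.ThreeLocal
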